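import Summits.CriticalPhenomena.SAWScalingLimit.Theorems.SAWLoopFugacityFlowAvoidancePassageSandwich
import Literature.Probability.RandomPlanarGeometry.KernelConvergence
import Literature.Probability.RandomPlanarGeometry.HullRestrictionNull
import Literature.Probability.RandomPlanarGeometry.HullSubdomainPullback
import Literature.Probability.RandomPlanarGeometry.JordanDomainProofs
import Literature.Probability.RandomPlanarGeometry.PlanarDomainsTopology
import Literature.Topology.PlaneTopology.JordanCurveProofs

/-!
# `AvoidanceOfLimit` (stmt-CriticalPhenomena-11198, route `SAWChargeContinuation`): monotone carved
super-domains of a hull subdomain and the kernel convergence of their pulled-back hulls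

Landing target:
`Summits/CriticalPhenomena/SAWScalingLimit/Theorems/SAWChargeContinuationAvoidanceOfLimitSuperdomains.lean`
(`--supports stmt-CriticalPhenomena-11198`). The planar-topology / complex-analysis half of the
portmanteau sandwich proving `AvoidanceOfLimit` (sibling file `…AvoidanceOfLimit`).

* `exists_monotone_superdomains` — for Dobrushin domains `D' ⊆ D` with the same marked points:
  Dobrushin domains `E n = D ∖ T n` with the marked points of `D`, `T n` closed, off `closure D'`,
  INCREASING in `n`, and eventually containing every point of `D ∖ closure D'`. Built from the
  carving bricks of the tree (`AvoidancePassage.exists_bite_data`, `exists_carve_finset`): the bites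
  of `D ∖ cl D'` are indexed by their carriers (two bites are equal or disjoint) and charted once and
  for all; at stage `n` the finitely many bites meeting the compact level
  `K_n = {‖z‖ ≤ n, dist(z, (D ∖ cl D')ᶜ) ≥ 1/(n+1)}` are carved along charted half-discs whose radii
  are running maxima in `n` — so the carved sets increase.
* `tendsto_restrictionDeriv_superdomains` — for a chordal uniformizing map `φ` of `D` and a hull
  subdomain `D'` with pulled-back `*`-hull `A`, the pulled-back hulls `A_n = cl(ℍ ∖ φ⁻¹(E n)) ↑ ⊆ A`
  of such super-domains are `*`-hulls (`IsStarHull.pullbackHull`) whose complements have kernel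
  `ℍ ∖ A` (every point of `ℍ` off `cl(φ⁻¹ D')` is eventually carved; no point of `φ⁻¹(∂D' ∩ D)` is
  interior, the frontier of a Jordan domain being the frontier of its exterior,
  `JordanDomain.frontier_subset_closure_exterior`), whence `Φ'_{A_n}(0) → Φ'_A(0)` by the continuity
  of `Φ'_·(0)` under kernel convergence (`HasRestrictionDeriv.tendsto_of_kernel_holds`, [LSW] proof of
  Lemma 3.5).
-/

noncomputable section

open scoped Topology NNReal
open Filter Set Metric
open Literature.Probability.RandomPlanarGeometry
open UpperHalfPlane (upperHalfPlaneSet isOpen_upperHalfPlaneSet)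

namespace Summit.CriticalPhenomena.SAWScalingLimit.Theorems.AvoidanceOfLimit

open Summit.CriticalPhenomena.SAWScalingLimit.Theorems.AvoidancePassage
/-! ### Monotone carved super-domains of a hull subdomain -/

/-- **Monotone outer approximation of a subdomain by carved super-domains.** For Dobrushin domains
`D' ⊆ D` with the same marked points there are Dobrushin domains `E n = D ∖ T n` with the marked
points of `D`, where the closed sets `T n` miss `closure D'`, increase with `n`, and eventually
contain every point of `D ∖ closure D'`. Construction: index the bites of `D ∖ cl D'`
(`exists_bite_data`) by their carriers (two bites are equal or disjoint), chart each once and for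
all, and at stage `n` carve (`exists_carve_finset`) the finitely many bites meeting the compact
level `K_n = {‖z‖ ≤ n, dist(z, (D ∖ cl D')ᶜ) ≥ 1/(n+1)}` along charted half-discs whose radii are
running maxima in `n`. [folklore] -/
theorem exists_monotone_superdomains (D D' : DobrushinDomain) (hsub : D'.carrier ⊆ D.carrier)
    (h0 : D'.pt 0 = D.pt 0) (h1 : D'.pt 1 = D.pt 1) :
    ∃ (E : ℕ → DobrushinDomain) (T : ℕ → Set ℂ), (∀ n, IsClosed (T n)) ∧
      (∀ n, Disjoint (T n) (closure D'.carrier)) ∧ (∀ n, (E n).carrier = D.carrier \ T n) ∧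
      (∀ n, (E n).pt 0 = D.pt 0) ∧ (∀ n, (E n).pt 1 = D.pt 1) ∧ Monotone T ∧
      ∀ z ∈ D.carrier, z ∉ closure D'.carrier → ∃ n, z ∈ T n := by
  classical
  have hab : D.pt 0 ≠ D.pt 1 := fun h ↦ absurd (D.pt_injective h) (by decide)
  have haF' : D.pt 0 ∈ frontier D'.carrier := h0 ▸ D'.pt_mem_frontier 0
  have hbF' : D.pt 1 ∈ frontier D'.carrier := h1 ▸ D'.pt_mem_frontier 1
  have hnot : ∀ i, D.pt i ∉ D.carrier := fun i hi ↦
    Set.disjoint_left.1 D.disjoint_carrier_frontier hi (D.pt_mem_frontier i)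
  -- bites, indexed by their carriers
  let IsBite : Set ℂ → Prop := fun S ↦ ∃ (B : JordanDomain) (h : ℂ ≃ₜ ℂ), B.carrier = S ∧
      B.carrier ⊆ D.carrier ∧ Disjoint B.carrier (closure D'.carrier) ∧
      (∃ W e : Set ℂ, IsOpen W ∧ Disjoint B.carrier W ∧ B.carrier ∪ W = D.carrier \ e ∧
        e ⊆ closure D'.carrier) ∧
      h '' (ball 0 1 ∩ upperHalfPlaneSet) = B.carrier ∧
        ∀ x : ℝ, |x| < 1 → h x ∈ frontier D.carrier ∧ h x ∉ closure D'.carrier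
  have hdata : ∀ i : {S : Set ℂ // IsBite S}, ∃ (B : JordanDomain) (h : ℂ ≃ₜ ℂ),
      B.carrier = i.1 ∧ B.carrier ⊆ D.carrier ∧ Disjoint B.carrier (closure D'.carrier) ∧
      (∃ W e : Set ℂ, IsOpen W ∧ Disjoint B.carrier W ∧ B.carrier ∪ W = D.carrier \ e ∧
        e ⊆ closure D'.carrier) ∧
      h '' (ball 0 1 ∩ upperHalfPlaneSet) = B.carrier ∧
        ∀ x : ℝ, |x| < 1 → h x ∈ frontier D.carrier ∧ h x ∉ closure D'.carrier := fun i ↦ i.2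
  choose B h hBS hBD hBcl hBW hhB hdiam using hdata
  -- every point of `D ∖ cl D'` lies in a bite
  have hcover : ∀ z ∈ D.carrier, z ∉ closure D'.carrier →
      ∃ i : {S : Set ℂ // IsBite S}, z ∈ i.1 := by
    intro z hzD hz
    obtain ⟨B₀, hzB, hBD₀, hBcl₀, hBW₀, h₀, hhB₀, hdiam₀⟩ :=
      exists_bite_data D.toJordanDomain D'.toJordanDomain hsub haF' hbF' hab (hnot 0) (hnot 1)
        hzD hz
    exact ⟨⟨B₀.carrier, B₀, h₀, rfl, hBD₀, hBcl₀, hBW₀, hhB₀, hdiam₀⟩, hzB⟩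
  -- two bites are equal or disjoint
  have hdich : ∀ i j : {S : Set ℂ // IsBite S}, i.1 = j.1 ∨ Disjoint i.1 j.1 := by
    intro i j
    obtain ⟨W, e, hWo, hd, hu, he⟩ := hBW i
    obtain ⟨W', e', hW'o, hd', hu', he'⟩ := hBW j
    have := eq_or_disjoint_of_sides (B i).isOpen hWo (B j).isOpen hW'o
      (B i).isConnected.isPreconnected (B j).isConnected.isPreconnected (B j).nonempty hd hd'
      hu hu' he he' (hBcl i) (hBcl j)
    rwa [hBS i, hBS j] at this
  have hpair : ∀ i j : {S : Set ℂ // IsBite S}, i ≠ j →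
      Disjoint (B i).carrier (B j).carrier := by
    intro i j hij
    rcases hdich i j with hij' | hij'
    · exact absurd (Subtype.ext hij') hij
    · rwa [hBS i, hBS j]
  have hopenI : ∀ i : {S : Set ℂ // IsBite S}, IsOpen (i.1 : Set ℂ) := fun i ↦ by
    rw [← hBS i]; exact (B i).isOpen
  -- compact exhaustion of `O = D ∖ cl D'`
  set O : Set ℂ := D.carrier \ closure D'.carrier with hO
  have hOo : IsOpen O := D.isOpen.sdiff isClosed_closure
  have hOc : Oᶜ.Nonempty := ⟨D.pt 0, fun hz ↦ hnot 0 hz.1⟩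
  set K : ℕ → Set ℂ := fun n ↦ {z : ℂ | ‖z‖ ≤ n ∧ 1 / ((n : ℝ) + 1) ≤ infDist z Oᶜ} with hK
  have hKc : ∀ n, IsCompact (K n) := fun n ↦ by
    refine Metric.isCompact_of_isClosed_isBounded ?_ ?_
    · exact (isClosed_le continuous_norm continuous_const).inter
        (isClosed_le continuous_const (continuous_infDist_pt _))
    · exact (isBounded_closedBall (x := (0 : ℂ)) (r := n)).subset fun z hz ↦
        mem_closedBall_zero_iff.2 hz.1
  have hKO : ∀ n, K n ⊆ O := fun n z hz ↦ by
    by_contra hzO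
    have h0' : infDist z Oᶜ = 0 := infDist_zero_of_mem hzO
    have := hz.2
    rw [h0'] at this
    exact absurd this (not_le.2 (by positivity))
  have hKmono : Monotone K := by
    intro m n hmn z hz
    have h1' : (m : ℝ) ≤ n := by exact_mod_cast hmn
    refine ⟨hz.1.trans h1', le_trans ?_ hz.2⟩
    exact one_div_le_one_div_of_le (by positivity) (by linarith)
  have hKexh : ∀ z ∈ O, ∃ n, z ∈ K n := by
    intro z hz
    have hpos : 0 < infDist z Oᶜ := (hOo.isClosed_compl.notMem_iff_infDist_pos hOc).1
      (fun h' ↦ h' hz)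
    obtain ⟨n₁, hn₁⟩ := exists_nat_one_div_lt hpos
    obtain ⟨n₂, hn₂⟩ := exists_nat_ge ‖z‖
    refine ⟨max n₁ n₂, ?_, ?_⟩
    · exact hn₂.trans (by exact_mod_cast le_max_right _ _)
    · refine le_trans ?_ hn₁.le
      have : (n₁ : ℝ) ≤ (max n₁ n₂ : ℕ) := by exact_mod_cast le_max_left _ _
      exact one_div_le_one_div_of_le (by positivity) (by linarith)
  -- finite subcovers of the levels by bites; the bites meeting a level
  have hfin : ∀ n, ∃ t : Finset {S : Set ℂ // IsBite S}, K n ⊆ ⋃ i ∈ t, (i.1 : Set ℂ) := by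
    intro n
    refine (hKc n).elim_finite_subcover (fun i : {S : Set ℂ // IsBite S} ↦ (i.1 : Set ℂ)) hopenI
      fun z hz ↦ ?_
    obtain ⟨i, hi⟩ := hcover z (hKO n hz).1 (hKO n hz).2
    exact mem_iUnion.2 ⟨i, hi⟩
  choose t ht using hfin
  set F : ℕ → Finset {S : Set ℂ // IsBite S} := fun n ↦
    (t n).filter fun i ↦ (K n ∩ i.1).Nonempty with hF
  have hmemF : ∀ n i, i ∈ F n ↔ (K n ∩ i.1).Nonempty := by
    intro n i
    simp only [hF, Finset.mem_filter, and_iff_right_iff_imp]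
    rintro ⟨x, hxK, hxi⟩
    obtain ⟨j, hj, hxj⟩ := mem_iUnion₂.1 (ht n hxK)
    rcases hdich i j with hij | hij
    · rwa [Subtype.ext hij]
    · exact absurd hxj (Set.disjoint_left.1 hij hxi)
  have hFmono : ∀ {m n : ℕ}, m ≤ n → F m ⊆ F n := by
    intro m n hmn i hi
    rw [hmemF] at hi ⊢
    exact hi.mono (inter_subset_inter_left _ (hKmono hmn))
  -- radii, made monotone in `n`
  have hrad : ∀ n (i : {S : Set ℂ // IsBite S}), ∃ ρ : ℝ, 0 < ρ ∧ ρ < 1 ∧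
      (i ∈ F n → K n ∩ i.1 ⊆ h i '' (ball 0 ρ ∩ upperHalfPlaneSet)) := by
    intro n i
    by_cases hi : i ∈ F n
    · have hit : i ∈ t n := (Finset.mem_filter.1 hi).1
      have hc : IsCompact (K n ∩ i.1) :=
        isCompact_inter_of_cover (hKc n) (t n) (fun j : {S : Set ℂ // IsBite S} ↦ (j.1 : Set ℂ))
          hopenI (ht n) (fun i _ j _ ↦ hdich i j) hit
      obtain ⟨ρ, hρ0, hρ1, hsub'⟩ := exists_lt_one_subset_image (hhB i) hc
        (by rw [hBS i]; exact inter_subset_right)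
      exact ⟨ρ, hρ0, hρ1, fun _ ↦ hsub'⟩
    · exact ⟨1 / 2, by norm_num, by norm_num, fun h' ↦ absurd h' hi⟩
  choose r hr0 hr1 hrK using hrad
  set ρ : ℕ → {S : Set ℂ // IsBite S} → ℝ := fun n i ↦
    (Finset.range (n + 1)).sup' ⟨0, by simp⟩ fun m ↦ r m i with hρ
  have hrρ : ∀ n i, r n i ≤ ρ n i := fun n i ↦
    Finset.le_sup' (fun m ↦ r m i) (by simp)
  have hρ0 : ∀ n i, 0 < ρ n i := fun n i ↦ (hr0 n i).trans_le (hrρ n i)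
  have hρ1 : ∀ n i, ρ n i < 1 := fun n i ↦ (Finset.sup'_lt_iff _).2 fun m _ ↦ hr1 m i
  have hρmono : ∀ i {m n : ℕ}, m ≤ n → ρ m i ≤ ρ n i := fun i m n hmn ↦
    Finset.sup'_le _ _ fun k hk ↦ Finset.le_sup' (fun m ↦ r m i)
      (by simp only [Finset.mem_range] at hk ⊢; omega)
  -- carving
  have hcarve : ∀ n, ∃ J : JordanDomain, J.carrier = D.carrier \
      ⋃ i ∈ F n, h i '' (closedBall 0 (ρ n i) ∩ {z : ℂ | 0 ≤ z.im}) := fun n ↦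
    exists_carve_finset D.toJordanDomain B h (ρ n) (hρ0 n) (hρ1 n) hBD hhB
      (fun i x hx ↦ (hdiam i x hx).1) (F n) (fun i _ j _ hij ↦ hpair i j hij)
  choose J hJ using hcarve
  set T : ℕ → Set ℂ := fun n ↦ ⋃ i ∈ F n, h i '' (closedBall 0 (ρ n i) ∩ {z : ℂ | 0 ≤ z.im})
    with hT
  have hTcl : ∀ n, IsClosed (T n) := fun n ↦ by
    refine Set.Finite.isClosed_biUnion (F n).finite_toSet fun i _ ↦ ?_
    exact (((isCompact_closedBall (0 : ℂ) (ρ n i)).inter_right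
      (isClosed_le continuous_const Complex.continuous_im)).image (h i).continuous).isClosed
  have hTD' : ∀ n, Disjoint (T n) (closure D'.carrier) := fun n ↦ by
    rw [Set.disjoint_left]
    intro z hz hzcl
    obtain ⟨i, -, hzi⟩ := mem_iUnion₂.1 hz
    rcases mem_image_closedHalfDisc (hρ1 n i) hzi with ⟨w, hw1, hwim, rfl⟩ | ⟨x, hx, rfl⟩
    · exact Set.disjoint_left.1 (hBcl i) (chart_mem_carrier (hhB i) hw1 hwim) hzcl
    · exact (hdiam i x hx).2 hzcl
  -- the marked points are frontier points of the carved domains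
  have hD'J : ∀ n, D'.carrier ⊆ (J n).carrier := fun n ↦ by
    rw [hJ n]
    exact fun z hz ↦ ⟨hsub hz, fun hzT ↦ Set.disjoint_left.1 (hTD' n) hzT (subset_closure hz)⟩
  have hfrJ : ∀ n i, D.pt i ∈ frontier (J n).carrier := by
    intro n i
    rw [(J n).isOpen.frontier_eq]
    refine ⟨closure_mono (hD'J n) ?_, fun hi ↦ hnot i (by rw [hJ n] at hi; exact hi.1)⟩
    fin_cases i
    · exact frontier_subset_closure haF'
    · exact frontier_subset_closure hbF'
  have hE : ∀ n, ∃ E : DobrushinDomain, E.carrier = (J n).carrier ∧ E.pt 0 = D.pt 0 ∧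
      E.pt 1 = D.pt 1 := fun n ↦
    exists_dobrushinDomain_of_mem_frontier (J n) (hfrJ n 0) (hfrJ n 1) hab
  choose E hEc hE0 hE1 using hE
  refine ⟨E, T, hTcl, hTD', fun n ↦ (hEc n).trans (hJ n), hE0, hE1, ?_, ?_⟩
  · -- monotone
    intro m n hmn z hz
    obtain ⟨i, hi, hzi⟩ := mem_iUnion₂.1 hz
    refine mem_iUnion₂.2 ⟨i, hFmono hmn hi, ?_⟩
    obtain ⟨w, ⟨hw1, hw2⟩, rfl⟩ := hzi
    exact ⟨w, ⟨closedBall_subset_closedBall (hρmono i hmn) hw1, hw2⟩, rfl⟩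
  · -- exhaustion
    intro z hzD hz
    obtain ⟨n, hn⟩ := hKexh z ⟨hzD, hz⟩
    obtain ⟨i, hzi⟩ := hcover z hzD hz
    have hiF : i ∈ F n := (hmemF n i).2 ⟨z, hn, hzi⟩
    refine ⟨n, mem_iUnion₂.2 ⟨i, hiF, ?_⟩⟩
    obtain ⟨w, ⟨hw1, hw2⟩, rfl⟩ := hrK n i hiF ⟨hn, hzi⟩
    refine ⟨w, ⟨?_, le_of_lt (show 0 < w.im from hw2)⟩, rfl⟩
    exact (ball_subset_ball (hrρ n i)).trans ball_subset_closedBall hw1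

/-! ### Carved super-domains are hull subdomains; their pulled-back hulls -/

section Pullback

variable {D D' : DobrushinDomain} {φ : ConformalEquiv upperHalfPlaneSet D.carrier}

/-- A carved super-domain `E = D ∖ T` (`T` closed, off `closure D'`, same marked points) of a
subdomain `D'` with the marked points of `D` is a hull subdomain of `D`. [folklore] -/
theorem isHullSubdomain_of_carrier_eq_diff {E : DobrushinDomain} {T : Set ℂ}
    (h0 : D'.pt 0 = D.pt 0) (h1 : D'.pt 1 = D.pt 1) (hTcl : IsClosed T)
    (hTD' : Disjoint T (closure D'.carrier)) (hE : E.carrier = D.carrier \ T)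
    (hE0 : E.pt 0 = D.pt 0) (hE1 : E.pt 1 = D.pt 1) : D.IsHullSubdomain E := by
  have hdiff : D.carrier \ E.carrier ⊆ T := by
    rw [hE]
    rintro z ⟨hzD, hzE⟩
    by_contra hzT
    exact hzE ⟨hzD, hzT⟩
  have hcl : closure (D.carrier \ E.carrier) ⊆ T := hTcl.closure_subset_iff.2 hdiff
  have hpt : ∀ i, D.pt i ∈ closure D'.carrier → D.pt i ∉ closure (D.carrier \ E.carrier) :=
    fun i hi hic ↦ Set.disjoint_left.1 hTD' (hcl hic) hi
  refine ⟨by rw [hE]; exact sdiff_subset, hE0, hE1, hpt 0 ?_, hpt 1 ?_⟩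
  · rw [← h0]; exact frontier_subset_closure (D'.pt_mem_frontier 0)
  · rw [← h1]; exact frontier_subset_closure (D'.pt_mem_frontier 1)

/-- The subdomain lies in each carved super-domain. [folklore] -/
theorem subset_of_carrier_eq_diff {E : DobrushinDomain} {T : Set ℂ} (hsub : D'.carrier ⊆ D.carrier)
    (hTD' : Disjoint T (closure D'.carrier)) (hE : E.carrier = D.carrier \ T) :
    D'.carrier ⊆ E.carrier := by
  rw [hE]
  exact fun z hz ↦ ⟨hsub hz, fun hzT ↦ Set.disjoint_left.1 hTD' hzT (subset_closure hz)⟩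

/-- Pulled-back hulls decrease with the subdomain. [folklore] -/
theorem pullbackHull_antitone {D₁ D₂ : DobrushinDomain} (h : D₁.carrier ⊆ D₂.carrier) :
    φ.pullbackHull D₂ ⊆ φ.pullbackHull D₁ :=
  closure_mono (sdiff_subset_sdiff_right fun _ hz ↦ ⟨hz.1, h hz.2⟩)

/-- A point of `ℍ` whose image lies in `closure D'` is in the closure of the pulled-back domain
(continuity of `φ⁻¹` on `D`). [folklore] -/
theorem mem_closure_pullbackDomain_of_apply_mem_closure (hsub : D'.carrier ⊆ D.carrier) {z : ℂ}
    (hz : z ∈ upperHalfPlaneSet) (hφz : φ z ∈ closure D'.carrier) :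
    z ∈ closure (φ.pullbackDomain D') := by
  have hcw : ContinuousWithinAt φ.symm D'.carrier (φ z) :=
    (φ.symm.continuousOn (φ z) (φ.mapsTo hz)).mono hsub
  have := hcw.mem_closure_image hφz
  rw [φ.symm_apply_apply hz] at this
  refine closure_mono ?_ this
  rintro _ ⟨w, hw, rfl⟩
  exact ConformalEquiv.symm_mapsTo_pullbackDomain hsub hw

/-- **Kernel convergence of the pulled-back hulls of a monotone carved exhaustion.** For a
chordal uniformizing map `φ` of `D`, a hull subdomain `D'` with pulled-back `*`-hull `A` and carved
super-domains `E n = D ∖ T n ⊇ D'` (`T n ↑` closed, off `cl D'`, eventually containing every point of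
`D ∖ cl D'`), the pulled-back hulls `A_n ↑ ⊆ A` are `*`-hulls whose complements have kernel
`ℍ ∖ A`, so `Φ'_{A_n}(0) → Φ'_A(0)` (`HasRestrictionDeriv.tendsto_of_kernel_holds`).
[cite: LawlerSchrammWerner2003Restriction, proof of Lemma 3.5 (p. 12)] -/
theorem tendsto_restrictionDeriv_superdomains (hφ : D.IsChordalUniformizing φ)
    (hD' : D.IsHullSubdomain D') {E : ℕ → DobrushinDomain} {T : ℕ → Set ℂ}
    (hTcl : ∀ n, IsClosed (T n)) (hTD' : ∀ n, Disjoint (T n) (closure D'.carrier))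
    (hE : ∀ n, (E n).carrier = D.carrier \ T n) (hE0 : ∀ n, (E n).pt 0 = D.pt 0)
    (hE1 : ∀ n, (E n).pt 1 = D.pt 1) (hmono : Monotone T)
    (hexh : ∀ z ∈ D.carrier, z ∉ closure D'.carrier → ∃ n, z ∈ T n)
    {Φ : ConformalEquiv (upperHalfPlaneSet \ φ.pullbackHull D') upperHalfPlaneSet} {d : ℝ}
    (hΦ : IsRestrictionMap (φ.pullbackHull D') Φ) (hd : HasRestrictionDeriv (φ.pullbackHull D') Φ d)
    {Φn : ∀ n, ConformalEquiv (upperHalfPlaneSet \ φ.pullbackHull (E n)) upperHalfPlaneSet}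
    {dn : ℕ → ℝ} (hΦn : ∀ n, IsRestrictionMap (φ.pullbackHull (E n)) (Φn n))
    (hdn : ∀ n, HasRestrictionDeriv (φ.pullbackHull (E n)) (Φn n) (dn n)) :
    Tendsto dn atTop (𝓝 d) := by
  have hsc : ∀ D : JordanDomain, D.isSimplyConnected := JordanDomain.isSimplyConnected_holds
  have hJ : Literature.Topology.PlaneTopology.JordanCurveTheorem :=
    Literature.Topology.PlaneTopology.JordanCurveTheorem_holds
  have hEn : ∀ n, D.IsHullSubdomain (E n) := fun n ↦
    isHullSubdomain_of_carrier_eq_diff hD'.pt_zero_eq hD'.pt_one_eq (hTcl n) (hTD' n) (hE n)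
      (hE0 n) (hE1 n)
  have hA : IsStarHull (φ.pullbackHull D') := IsStarHull.pullbackHull hsc hφ hD'
  have hAn : ∀ n, IsStarHull (φ.pullbackHull (E n)) := fun n ↦
    IsStarHull.pullbackHull hsc hφ (hEn n)
  have hD'E : ∀ n, D'.carrier ⊆ (E n).carrier := fun n ↦
    subset_of_carrier_eq_diff hD'.carrier_subset (hTD' n) (hE n)
  have hmonoA : Monotone fun n ↦ φ.pullbackHull (E n) := by
    intro m n hmn
    refine pullbackHull_antitone ?_
    rw [hE m, hE n]
    exact sdiff_subset_sdiff_right (hmono hmn)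
  have hsubA : ∀ n, φ.pullbackHull (E n) ⊆ φ.pullbackHull D' := fun n ↦
    pullbackHull_antitone (hD'E n)
  -- the kernel of the complements is `ℍ ∖ A`
  have hker : interior (⋂ n, upperHalfPlaneSet \ φ.pullbackHull (E n)) =
      upperHalfPlaneSet \ φ.pullbackHull D' := by
    set N := interior (⋂ n, upperHalfPlaneSet \ φ.pullbackHull (E n)) with hN
    have hNopen : IsOpen N := isOpen_interior
    have hNsub : N ⊆ ⋂ n, upperHalfPlaneSet \ φ.pullbackHull (E n) := interior_subset
    have hNH : N ⊆ upperHalfPlaneSet := fun z hz ↦ ((mem_iInter.1 (hNsub hz)) 0).1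
    -- points of `N` are in `closure (ℍ ∖ A)`: otherwise their image is eventually carved
    have hNcl : ∀ z ∈ N, z ∈ closure (φ.pullbackDomain D') := by
      intro z hz
      by_contra hzc
      have hzH : z ∈ upperHalfPlaneSet := hNH hz
      have hφzD : φ z ∈ D.carrier := φ.mapsTo hzH
      have hφz : φ z ∉ closure D'.carrier := fun hcl ↦
        hzc (mem_closure_pullbackDomain_of_apply_mem_closure hD'.carrier_subset hzH hcl)
      obtain ⟨n, hn⟩ := hexh (φ z) hφzD hφz
      have hzn := (mem_iInter.1 (hNsub hz)) n
      rw [ConformalEquiv.diff_pullbackHull] at hzn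
      have h2 : φ z ∈ (E n).carrier := hzn.2
      rw [hE n] at h2
      exact h2.2 hn
    refine Subset.antisymm ?_ ?_
    · intro z hz
      rw [ConformalEquiv.diff_pullbackHull]
      refine ⟨hNH hz, ?_⟩
      by_contra hzD'
      -- `φ z ∈ ∂D'`, in the closure of the exterior of `D'`
      have hφz : φ z ∈ frontier D'.carrier := by
        rw [frontier, D'.isOpen.interior_eq]
        exact ⟨apply_mem_closure_of_mem_closure (hNH hz) (hNcl z hz), hzD'⟩
      have hext : φ z ∈ closure (closure D'.carrier)ᶜ :=
        D'.toJordanDomain.frontier_subset_closure_exterior hJ hφz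
      have himg : IsOpen (D.carrier ∩ φ.symm ⁻¹' N) :=
        φ.symm.continuousOn.isOpen_inter_preimage D.isOpen hNopen
      have hmem : φ z ∈ D.carrier ∩ φ.symm ⁻¹' N :=
        ⟨φ.mapsTo (hNH hz), by rw [mem_preimage, φ.symm_apply_apply (hNH hz)]; exact hz⟩
      rw [mem_closure_iff_nhds] at hext
      obtain ⟨w₁, ⟨hw₁D, hw₁N⟩, hw₁⟩ := hext _ (himg.mem_nhds hmem)
      have hz₁ : φ.symm w₁ ∈ N := hw₁N
      have := apply_mem_closure_of_mem_closure (hNH hz₁) (hNcl _ hz₁)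
      rw [φ.apply_symm_apply hw₁D] at this
      exact hw₁ this
    · refine interior_maximal (subset_iInter fun n ↦ ?_) ?_
      · exact sdiff_subset_sdiff_right (hsubA n)
      · rw [ConformalEquiv.diff_pullbackHull]
        exact ConformalEquiv.isOpen_pullbackDomain
  exact HasRestrictionDeriv.tendsto_of_kernel_holds hA hAn hmonoA hsubA hker hΦ hd hΦn hdn

end Pullback

end Summit.CriticalPhenomena.SAWScalingLimit.Theorems.AvoidanceOfLimit

end
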